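import Summits.PneNP.PneNP.Theorems.LatticeMagicTargetStubBridgeStudent

/-!
# `stub_bridge`, part 6/6: the lock-step simulation, Hypothesis (ST), and `stub_bridge`

Line `SketchIdeator5` of crux `Target` (stmt-PneNP-10709), stub `stub_bridge`: game-hard + injective
+ polynomial time (+ Cook–Levin with the Levin witness map, the hypothesis `hlevin`) ⟹ Krajíček's
Hypothesis (ST) for some Cook–Reckhow proof system `V` for `TAUT` (arXiv:2506.20221 §2, after
Krajíček, LMCS 16 (3:9) 2020). Contents:

* a play of the game student against a teacher: the reveals, the `DD_V`-teacher `ddT` (transported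
  Levin witnesses, read off the play by round number), **`lockstep`** (`DD_V`-round `m` ↔ game round
  `m + 1`: the student's replay is the `DD_V`-history and its proposal is the vector of the proposed
  index), **`ddLegal`** (legality transfers: a non-tautological disjunct has a wrong coordinate by
  injectivity, the game teacher reveals one, the witness falsifies the disjunct) and **`not_ddWins`**
  (a tautological disjunct is an entirely correct proposal);
* the decider of `R_{g,B}` (`relF`, `relR_mem_P`);
* **`stub_bridge`**, assembling: `V₀` from `exists_isProofSystemFor_TAUT_holds`, `Φ, gen, wit` from
  `hlevin` at `R_{g,B}` and `p = X`, the generator from `codeFP_genForm`, `V = bridgeV V₀ (bridgeF Fc)`,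
  and for `k, S` the game at `k + 1` rounds against the student of `exists_student`.

## References

* J. Krajíček, *A proof complexity conjecture and the Incompleteness theorem*, arXiv:2506.20221, §2
  (`DD_P`, Hypothesis (ST)); J. Krajíček, LMCS 16 (3:9) 2020.
* S. Arora, B. Barak, *Computational Complexity: A Modern Approach*, CUP 2009, §0.1 (codes), §1.3
  (closure of polynomial time), §2.3 (CNFs, Cook–Levin), Example 2.21.
* S. A. Cook, R. A. Reckhow, JSL 44 (1979), §1 (proof systems).
-/

set_option linter.dupNamespace false -- summit = sub-problem (D-0017)

namespace Summit.PneNP.PneNP.Theorems.LatticeMagicTarget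

open Literature.Computability.Complexity
open Literature.Computability.MetaComplexity
open _root_.Computability

namespace StubBridge

section Simulation

open Brick CodeFP

variable {t : ℕ}

variable {V : List Bool → List Bool → Bool} (Φ : List Bool → CNF ℕ) (wit S : List Bool → List Bool) (K : ℕ)

/-! #### A play of the game student against a teacher -/

variable (g : List Bool → List Bool) (B : List Bool → Bool) (S' : List Bool → List Bool) (T : Teacher t)
  (I : HBInstance t) (n : ℕ)

/-- The context the game student regenerates: `(1ⁿ, images)`. -/
def gctx : Ctx := (unE n, imgs g I)

/-- The coordinate revealed in round `r`. -/
def rev (r : ℕ) : Fin t := T (hbProposal g S' T I r) (hbHist g S' T I r)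

/-- The reveals of rounds `1, …, m` (the tail of the history after round `m`). -/
def reveals : ℕ → List Entry
  | 0 => []
  | m + 1 => reveals m ++ [((rev g S' T I (m + 1) : ℕ), I.u (rev g S' T I (m + 1)))]

/-- The `DD_V`-teacher's answer in round `r`: the transported Levin witness for the reveal of game
round `r + 1`, at the bit the game student proposed there. -/
def ansA (r : ℕ) : List Bool :=
  stretch t (false :: wit (boolPair (xin (unE n) ((imgs g I).getD (rev g S' T I (r + 1)) [])
    ((hbProposal g S' T I (r + 1)).getD (rev g S' T I (r + 1)) false)) (I.u (rev g S' T I (r + 1)))))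

/-- **The `DD_V`-teacher** read off the play (she only looks at the round number). -/
def ddT : DDTeacher := fun _ H => ansA wit g S' T I n H.length

/-- One more round of the game history. -/
theorem hbHist_succ (r : ℕ) :
    hbHist g S' T I (r + 1) = hbHist g S' T I r ++ [((rev g S' T I r : ℕ), I.u (rev g S' T I r))] := rfl

/-- Length of the reveals list. -/
theorem length_reveals : ∀ m, (reveals g S' T I m).length = m
  | 0 => rfl
  | m + 1 => by rw [reveals, List.length_append, length_reveals m]; rfl

/-- The history after round `m`: the round-`0` reveal, then the later reveals. -/
theorem hbHist_succ_eq_cons : ∀ m,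
    hbHist g S' T I (m + 1) = ((rev g S' T I 0 : ℕ), I.u (rev g S' T I 0)) :: reveals g S' T I m
  | 0 => rfl
  | m + 1 => by rw [hbHist_succ, hbHist_succ_eq_cons m, reveals, List.cons_append]

variable {Φ wit S K g S' I n}

/-- **What the game student proposes** from round `1` on. -/
theorem hbProposal_succ (hI : ∀ j, (I.u j).length = n)
    (hS' : ∀ (ws : List (List Bool)) (h : List Entry),
      S' (pairE (rawE strE) (rawE entE) (ws, h)) = studentFn Φ wit S t K ws h) (m : ℕ) :
    hbProposal g S' T I (m + 1) =
      vecOf t (idxOf Φ S t (gctx g I n) (replay Φ wit S t K (gctx g I n) (reveals g S' T I m) [])) := by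
  rw [hbProposal, hbView_eq, hS', hbHist_succ_eq_cons, studentFn, hI]
  rfl

variable (hI : ∀ j, (I.u j).length = n)
  (hS' : ∀ (ws : List (List Bool)) (h : List Entry),
    S' (pairE (rawE strE) (rawE entE) (ws, h)) = studentFn Φ wit S t K ws h)
  (J : DDInstance V) (hl : J.l = disjuncts Φ (paramOf t (gctx g I n))) (hπ : J.π = piStr t (gctx g I n))
include hI hS' hl hπ

/-- **The lock-step lemma**: for `m ≤ K`, the game student's replay of the reveals of rounds `1..m`
is the `DD_V`-history after `m` rounds against `ddT`, and its proposal in round `m + 1` is the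
vector of the index proposed in `DD_V`-round `m`. -/
theorem lockstep : ∀ m, m ≤ K →
    replay Φ wit S t K (gctx g I n) (reveals g S' T I m) [] = ddHist S (ddT wit g S' T I n) J m ∧
      hbProposal g S' T I (m + 1) = vecOf t (ddProposal S (ddT wit g S' T I n) J m)
  | 0, _ => by
    refine ⟨by rw [reveals, replay_nil]; rfl, ?_⟩
    rw [hbProposal_succ T hI hS', ddProposal_eq Φ S _ J hl hπ, reveals, replay_nil]
    rfl
  | m + 1, hm => by
    obtain ⟨ih1, ih2⟩ := lockstep m (Nat.le_of_succ_le hm)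
    have key : replay Φ wit S t K (gctx g I n) (reveals g S' T I (m + 1)) [] =
        ddHist S (ddT wit g S' T I n) J (m + 1) := by
      rw [reveals, replay_append_singleton Φ wit S _ _ _ K [] (by rw [length_reveals]; omega), ih1,
        ← ddProposal_eq Φ S _ J hl hπ]
      show _ = ddHist S (ddT wit g S' T I n) J m ++ [(ddProposal S (ddT wit g S' T I n) J m,
        ddT wit g S' T I n (ddProposal S (ddT wit g S' T I n) J m) (ddHist S (ddT wit g S' T I n) J m))]
      congr 3
      rw [ddT, length_ddHist, ansA, ansOf, ih2]
      rfl
    refine ⟨key, ?_⟩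
    rw [hbProposal_succ T hI hS', key, ddProposal_eq Φ S _ J hl hπ]

omit hI hS' hπ in
/-- The disjunct at a listed index: the disjunct of a vector of length `t`, which is `vecOf t i`. -/
theorem disjunct_of_getElem? (ht : (imgs g I).length = t) {i : ℕ} {φ : PropForm ℕ} (hφ : J.l[i]? = some φ) :
    (vecOf t i).length = t ∧ φ = disjunct Φ (unE n) (imgs g I) (vecOf t i) := by
  rw [hl, disjuncts, paramOf] at hφ
  simp only [gctx] at hφ
  rw [vecsFold_eq_allVecs (by rw [ht]; have := Nat.one_le_two_pow (n := t); omega), ht, List.getElem?_map] at hφ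
  cases hv : (allVecs t)[i]? with
  | none => rw [hv] at hφ; cases hφ
  | some v =>
    rw [hv] at hφ
    have hvec : vecOf t i = v := by rw [vecOf, List.getD_eq_getElem?_getD, hv]; rfl
    rw [hvec]
    exact ⟨mem_allVecs_iff.1 (List.mem_of_getElem? hv), (Option.some.inj hφ).symm⟩

/-- **Legality transfers**: against a legal game teacher (for `K = k + 1` rounds) the `DD_V`-teacher
`ddT` is legal for `k` rounds — a non-tautological proposed disjunct has a wrong coordinate, the game
teacher reveals one, and the transported Levin witness falsifies the disjunct. -/
theorem ddLegal {k : ℕ} (hK : K = k + 1) (ht : (imgs g I).length = t)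
    (hΦ : ∀ (N w : List Bool) (b : Bool),
      (Φ (xin N w b)).Satisfiable ↔ ∃ u : List Bool, u.length = N.length ∧ g u = w ∧ B u ≠ b)
    (hinj : InjOnLengths g)
    (hwit : ∀ (N w : List Bool) (b : Bool) (u : List Bool), u.length = N.length → g u = w → B u ≠ b →
      (Φ (xin N w b)).eval (fun y => (wit (boolPair (xin N w b) u)).getD y false) = true)
    (hlegal : HBLegal g B S' T I K) : DDLegal S (ddT wit g S' T I n) J k := by
  intro m hm φ hφ hnt
  obtain ⟨hlen, rfl⟩ := disjunct_of_getElem? J hl ht hφ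
  have hprop := (lockstep T hI hS' J hl hπ m (by omega)).2
  set v := vecOf t (ddProposal S (ddT wit g S' T I n) J m) with hv
  have hIn : ∀ j, (I.u j).length = (unE n).length := fun j => by rw [length_unE]; exact hI j
  -- a wrong coordinate exists, so the revealed one is wrong
  have hex : ∃ j, Wrong B I v j := by
    by_contra hall
    push Not at hall
    exact hnt (isTautology_disjunct_of_forall_not_wrong g B hΦ hinj hIn hall)
  have hwrong : Wrong B I v (rev g S' T I (m + 1)) := by
    have := hlegal (m + 1) (by omega) (by rwa [hprop])
    show Wrong B I v (T (hbProposal g S' T I (m + 1)) (hbHist g S' T I (m + 1)))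
    rw [hprop] at this ⊢
    exact this
  set j := rev g S' T I (m + 1) with hj
  -- the teacher's answer is the transported witness of block `j`
  have hans : ddT wit g S' T I n (ddProposal S (ddT wit g S' T I n) J m) (ddHist S (ddT wit g S' T I n) J m) =
      stretch v.length (false :: wit (boolPair (xin (unE n) (g (I.u j)) (v.getD j false)) (I.u j))) := by
    rw [ddT, length_ddHist, ansA, hprop, hlen, ← hj]
    congr 5
    rw [List.getD_eq_getElem?_getD, getElem?_imgs]; rfl
  rw [hans]
  exact eval_disjunct_eq_false (getElem?_imgs g I j) (hwit _ _ _ _ (hIn j) rfl hwrong)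

omit hS' hπ in
/-- **Winning transfers back**: a tautological proposed disjunct within `k` rounds would be an
entirely correct proposal of the game student within `K = k + 1` rounds. -/
theorem not_ddWins {k : ℕ} (hK : K = k + 1) (ht : (imgs g I).length = t)
    (hS' : ∀ (ws : List (List Bool)) (h : List Entry),
      S' (pairE (rawE strE) (rawE entE) (ws, h)) = studentFn Φ wit S t K ws h)
    (hπ : J.π = piStr t (gctx g I n))
    (hΦ : ∀ (N w : List Bool) (b : Bool),
      (Φ (xin N w b)).Satisfiable ↔ ∃ u : List Bool, u.length = N.length ∧ g u = w ∧ B u ≠ b)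
    (hwin : ¬ HBWins g B S' T I K) : ¬ DDWins S (ddT wit g S' T I n) J k := by
  rintro ⟨m, hm, φ, hφ, htaut⟩
  obtain ⟨-, rfl⟩ := disjunct_of_getElem? J hl ht hφ
  have hprop := (lockstep T hI hS' J hl hπ m (by omega)).2
  have hIn : ∀ j, (I.u j).length = (unE n).length := fun j => by rw [length_unE]; exact hI j
  refine hwin ⟨m + 1, by omega, fun j => ?_⟩
  rw [hprop]
  exact not_wrong_of_isTautology_disjunct g B hΦ hIn htaut j

end Simulation

/-! ## Part 7: assembly -/

section Assembly

open Brick Plumb CodeFP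

variable {g : List Bool → List Bool} {B : List Bool → Bool}

/-- The decider of `R_{g,B}`: length test, image test, bit test. -/
noncomputable def relF (g : List Bool → List Bool) (Bf : List Bool → List Bool) : List Bool → List Bool :=
  andFn (eqPairFn ∘ fanoutFn (onesFn ∘ sndF) (onesFn ∘ fstF ∘ fstF))
    (andFn (eqPairFn ∘ fanoutFn (g ∘ sndF) (nthF 1 ∘ fstF))
      (eqPairFn ∘ fanoutFn (sndPow 1 ∘ fstF) (notFn (Bf ∘ sndF))))

/-- `relF ∈ FP`. -/
theorem relF_mem_FP (hg : g ∈ FP) {Bf : List Bool → List Bool} (hBf : Bf ∈ FP) : relF g Bf ∈ FP := by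
  unfold relF
  exact andFn_mem_FP (comp_mem_FP eqPairFn_mem_FP (fanoutFn_mem_FP (comp_mem_FP onesFn_mem_FP sndF_mem_FP)
      (comp_mem_FP onesFn_mem_FP (comp_mem_FP fstF_mem_FP fstF_mem_FP))))
    (andFn_mem_FP (comp_mem_FP eqPairFn_mem_FP (fanoutFn_mem_FP (comp_mem_FP hg sndF_mem_FP)
      (comp_mem_FP (nthF_mem_FP 1) fstF_mem_FP)))
      (comp_mem_FP eqPairFn_mem_FP (fanoutFn_mem_FP (comp_mem_FP (sndPow_mem_FP 1) fstF_mem_FP)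
        (notFn_mem_FP (comp_mem_FP hBf sndF_mem_FP)))))

/-- The indicator bit of `R_{g,B}` read off the total decoder. -/
def relBit (g : List Bool → List Bool) (B : List Bool → Bool) (y : List Bool) : Bool :=
  decide ((sndF y).length = (fstF (fstF y)).length) &&
    (decide (g (sndF y) = nthF 1 (fstF y)) && decide (sndPow 1 (fstF y) = [!B (sndF y)]))

/-- Membership in `R_{g,B}` is the indicator bit. -/
theorem mem_relR_iff_relBit (y : List Bool) : y ∈ relR g B ↔ relBit g B y = true := by
  change ((sndF y).length = (fstF (fstF y)).length ∧ g (sndF y) = nthF 1 (fstF y) ∧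
    sndPow 1 (fstF y) = [!B (sndF y)]) ↔ _
  simp [relBit]

/-- **Value of the decider**: the indicator bit of `R_{g,B}`. -/
theorem relF_apply (y : List Bool) : relF g (fun z => [B z]) y = [relBit g B y] := by
  have hones : ∀ a b : List Bool, onesFn a = onesFn b ↔ a.length = b.length := fun a b =>
    ⟨fun h => by simpa using congrArg List.length h, fun h => by rw [onesFn, onesFn, h]⟩
  have h1 : (eqPairFn ∘ fanoutFn (onesFn ∘ sndF) (onesFn ∘ fstF ∘ fstF)) y =
      [decide ((sndF y).length = (fstF (fstF y)).length)] := by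
    simp [eqPairFn_boolPair, hones]
  have h2 : (eqPairFn ∘ fanoutFn (g ∘ sndF) (nthF 1 ∘ fstF)) y = [decide (g (sndF y) = nthF 1 (fstF y))] := by
    simp [eqPairFn_boolPair]
  have h3 : (eqPairFn ∘ fanoutFn (sndPow 1 ∘ fstF) (notFn ((fun z => [B z]) ∘ sndF))) y =
      [decide (sndPow 1 (fstF y) = [!B (sndF y)])] := by
    simp only [Function.comp_apply, fanoutFn_apply, eqPairFn_boolPair,
      notFn_apply (show ((fun z => [B z]) ∘ sndF) y = [B (sndF y)] from rfl)]
  rw [relF, andFn_apply h1 (andFn_apply h2 h3), relBit]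

/-- **`R_{g,B} ∈ P`** for polynomial-time `g` and `B`. -/
theorem relR_mem_P (hg : g ∈ FP) (hBf : (fun z => [B z]) ∈ FP) : relR g B ∈ Classes.P :=
  mem_P_of_mem_FP (relF_mem_FP hg hBf) _ fun y => by
    rw [relF_apply, mem_relR_iff_relBit]
    cases relBit g B y <;> simp

end Assembly

end StubBridge

open StubBridge in
/-- **BRIDGE** (`stub_bridge`; Krajíček arXiv:2506.20221 §2 with LMCS 16(3:9) 2020, the route from
the hard bit-vector game to Hypothesis (ST)). If `g` is polynomial time and injective on each length,
`B` is polynomial time, and the hard-bit vector game for `(g, B)` is hard for `FP` students with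
`O(1)` rounds, then — given Cook–Levin with the Levin witness map (`hlevin`) — some Cook–Reckhow proof
system `V` for `TAUT` has `DD_V ∉ ST[FP, O(1)]`.

`V` is `bridgeV V₀ F`: a `V₀`-proof (any proof system for `TAUT`, `exists_isProofSystemFor_TAUT_holds`)
or the claim that the statement is `F r`, `F ∈ FP` regenerating from `r = ⟨1ⁿ, ⟨w⃗, pad⟩⟩` the code of
`⋁_{v ∈ {0,1}ᵗ} ⋀_j ¬Φ⟨1ⁿ, ⟨w_j, [v_j]⟩⟩` with blocks relabelled apart (`genForm`), a tautology for every
`r` because `g` is injective (`isTautology_genForm`). A `DD_V`-student `S ∈ FP` becomes the game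
student `studentFn` (`exists_student`), defeated by `hgame` at `k + 1` rounds; the `DD_V`-teacher
`ddT` answers transported Levin witnesses; `lockstep`, `ddLegal`, `not_ddWins` transfer legality and
(non-)winning. -/
theorem stub_bridge
    (hlevin : ∀ (R : Language Bool), R ∈ Classes.P → ∀ p : Polynomial ℕ,
      ∃ (Φ : List Bool → CNF ℕ) (gen wit : List Bool → List Bool), gen ∈ FP ∧ wit ∈ FP ∧
        (∀ x, gen x = encodingCNF.encode (Φ x)) ∧
        (∀ x, (Φ x).Satisfiable ↔ ∃ u : List Bool, u.length ≤ p.eval x.length ∧ boolPair x u ∈ R) ∧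
        (∀ x u, u.length ≤ p.eval x.length → boolPair x u ∈ R →
          (Φ x).eval (fun i => (wit (boolPair x u)).getD i false) = true))
    (g : List Bool → List Bool) (B : List Bool → Bool)
    (hpoly : PolyTimeComputable id id g) (hBpoly : PolyTimeComputable id encodeBool B)
    (hinj : InjOnLengths g) (hgame : STGameHard g B) :
    ∃ V : List Bool → List Bool → Bool, IsProofSystemFor V TAUT ∧ STHyp V := by
  -- the base proof system and the relation `R_{g,B} ∈ P`
  obtain ⟨V₀, hV₀⟩ := exists_isProofSystemFor_TAUT_holds
  have hBf : (fun z => [B z]) ∈ FP := hBpoly.of_encode (fun z => z) (fun _ => rfl) (fun _ => rfl)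
  obtain ⟨Φ, gen, wit, hgen, hwit, hgenΦ, hsat, hwitsat⟩ := hlevin _ (relR_mem_P hpoly hBf) Polynomial.X
  have hlen : ∀ (N w : List Bool) (b : Bool) (u : List Bool), u.length = N.length →
      u.length ≤ Polynomial.X.eval (xin N w b).length := fun N w b u hu => by
    rw [Polynomial.eval_X, xin, length_boolPair]; omega
  have hΦ : ∀ (N w : List Bool) (b : Bool),
      (Φ (xin N w b)).Satisfiable ↔ ∃ u : List Bool, u.length = N.length ∧ g u = w ∧ B u ≠ b := by
    intro N w b
    rw [hsat]
    constructor
    · rintro ⟨u, -, hu⟩; exact ⟨u, (mem_relR_iff N w b u).1 hu⟩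
    · rintro ⟨u, hu⟩; exact ⟨u, hlen N w b u hu.1, (mem_relR_iff N w b u).2 hu⟩
  have hwit' : ∀ (N w : List Bool) (b : Bool) (u : List Bool), u.length = N.length → g u = w → B u ≠ b →
      (Φ (xin N w b)).eval (fun y => (wit (boolPair (xin N w b) u)).getD y false) = true :=
    fun N w b u h1 h2 h3 => hwitsat _ _ (hlen N w b u h1) ((mem_relR_iff N w b u).2 ⟨h1, h2, h3⟩)
  -- the generator and the proof system
  obtain ⟨Fc, hFc, hFcG⟩ := codeFP_genForm (Φ := Φ) hgen hgenΦ
  refine ⟨bridgeV V₀ (bridgeF Fc), isProofSystemFor_bridge hV₀ hFc hFcG hΦ hinj, fun k S hS => ?_⟩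
  -- Hypothesis (ST): play the game at `k + 1` rounds with the student built from `S`
  obtain ⟨S', hS'FP, hS'⟩ := exists_student (Φ := Φ) (2 * (k + 1) + 2) (k + 1) hS hwit hgen hgenΦ
  obtain ⟨n, -, I, hI, T, hlegal, hwin⟩ := hgame (k + 1) S' hS'FP 0
  have ht : (imgs g I).length = 2 * (k + 1) + 2 := by simp [imgs]; omega
  have hguard : StubBridge.guard (paramOf (2 * (k + 1) + 2) (gctx g I n)) = true := by
    have h1 := Nat.one_le_two_pow (n := 2 * (k + 1) + 2)
    simp only [StubBridge.guard, paramOf, gctx, ht, decide_eq_true_eq]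
    omega
  have hproves : bridgeV V₀ (bridgeF Fc) (encE (bigDisj (disjuncts Φ (paramOf (2 * (k + 1) + 2) (gctx g I n)))))
      (piStr (2 * (k + 1) + 2) (gctx g I n)) = true := by
    rw [piStr, bridgeV, bridgeF_paramE hFcG, genForm, if_pos hguard]
    exact decide_eq_true rfl
  let J : DDInstance (bridgeV V₀ (bridgeF Fc)) :=
    ⟨disjuncts Φ (paramOf (2 * (k + 1) + 2) (gctx g I n)), piStr (2 * (k + 1) + 2) (gctx g I n),
      pairwise_disjoint_disjuncts hguard, hproves⟩
  exact ⟨J, ddT wit g S' T I n, ddLegal B T hI hS' J rfl rfl rfl ht hΦ hinj hwit' hlegal,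
    not_ddWins B T hI J rfl rfl ht hS' rfl hΦ hwin⟩

end Summit.PneNP.PneNP.Theorems.LatticeMagicTarget
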